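import Mathlib
import Literature.Barriers.MatrixMultiplication.NormalizerBarrier
import Literature.RepresentationTheory.FiniteGroups.IrreducibleCharacters
import Literature.RepresentationTheory.FiniteGroups.InducedClassFunction
import Literature.RepresentationTheory.FiniteGroups.MonomialRepresentation
import Summits.MatrixMultiplication.MatrixMultiplication.Theorems.LieRankDesigns.Negative.Basics
import Summits.MatrixMultiplication.MatrixMultiplication.Theorems.SubgroupIdentityDesigns.Negative.GrassmannOrbits
import Summits.MatrixMultiplication.MatrixMultiplication.Theorems.SubgroupIdentityDesigns.Negative.FlagCharacter
import Summits.MatrixMultiplication.MatrixMultiplication.Theorems.SubgroupIdentityDesigns.Negative.FlagTwist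

/-!
# `⟨Ψ_χ, Ψ_χ⟩ = 1` for distinct non-trivial `χ_i` (Mackey by hand)

Supports stmt-MatrixMultiplication-14079 (crux `SubgroupIdentityDesigns`, route
    `LevelGradedCohnUmans`;
BLOCK-SLICES §2).  VALUE = theorem, NOT summit progress.

For the twisted flag character `Ψ_χ = Ind_{P'}^G λ_χ` of `FlagTwist`:
* `card_mul_classInner` — Frobenius reciprocity `|P'| ⟨Ψ_χ, Ψ_χ⟩ = ∑_{s ∈ P'} λ_χ(s)⁻¹ Ψ_χ(s)
  = ∑_q cosetTerm q`, `cosetTerm_eq_sum_fq` — the coset term of `q` is the sum over the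
  stabiliser `P'_q` of the linear character `f_q(s) = λ_χ(g_q⁻¹ s g_q) / λ_χ(s)`;
* `cosetTerm_base` — the base coset contributes `|P'|`;
* `fq_ne_one` — for `q ≠ P'` and `χ_i` DISTINCT and NON-TRIVIAL, `f_q ≠ 1`: write
  `q = s₀ w(τ) P'` (Bruhat, `exists_perm_orbit`) with `τ(c_j) ≠ c_j` for some `j < k`; the torus
  elements `s₀ diag(δ_{τ c_j}^x) s₀⁻¹` stabilise `q` and `f_q` takes the value
  `χ_j(x) / λ_χ(diag(δ_{τ c_j}^x)) ∈ {χ_j(x)/χ_{i₁}(x), χ_j(x)}`, not identically `1`;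
  hence `cosetTerm_eq_zero` (`sum_hom_units_eq_zero`) and **`classInner_twChar : ⟨Ψ_χ,Ψ_χ⟩ = 1`**
  (so `Ψ_χ` is irreducible, `isIrrChar_twChar`).
The no-go for all `l ≥ 3`, `p ≥ k + 2` is in `FlagTwistNoGo`.
-/

set_option linter.dupNamespace false

noncomputable section

open scoped BigOperators Matrix Classical
open Literature.RepresentationTheory.FiniteGroups

namespace Summit.MatrixMultiplication.MatrixMultiplication.Theorems.SubgroupIdentityDesigns.Negative
namespace FlagTwistNorm

open GrassmannOrbits (permGL)
open FlagCharacter (flagStab permGL_mem_flagStab exists_perm_orbit)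
open FlagTwist (lam lam_conj twChar twChar_apply isCharacter_twChar isClassFun_twChar diagGL
  diagGL_mem conj_diagGL lam_diagGL_mulSingle_castAdd lam_diagGL_mulSingle_of_ne)
open LineStabilizerCharacter (multiset_eq_singleton)

variable {F : Type} [Field F] [Fintype F] [DecidableEq F] {k l : ℕ}

/-! ## Frobenius reciprocity and the coset terms -/

/-- **`|P'| ⟨Ψ_χ, Ψ_χ⟩ = ∑_{s ∈ P'} λ_χ(s)⁻¹ Ψ_χ(s)`.** -/
theorem card_mul_classInner (χ : Fin k → MulChar F ℂ) :
    (Fintype.card (flagStab F k l) : ℂ) * classInner (twChar (l := l) χ) (twChar χ) =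
      ∑ s : flagStab F k l, ((lam χ s : ℂˣ) : ℂ)⁻¹ * twChar χ (s : GL (Fin (k + l)) F) := by
  have hP : (Fintype.card (flagStab F k l) : ℂ) ≠ 0 := Nat.cast_ne_zero.mpr Fintype.card_ne_zero
  conv_lhs => rw [twChar, classInner_indClassFun_left _ _ (isClassFun_indClassFun _ _),
    classInner_apply]
  rw [← mul_assoc, mul_inv_cancel₀ hP, one_mul]
  refine Fintype.sum_equiv (Equiv.inv (flagStab F k l)) _ _ fun s => ?_
  simp only [Equiv.inv_apply, inv_inv, map_inv, Units.val_inv_eq_inv_val]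
  rfl

/-- The coset term `T(q) = ∑_{s ∈ P'} λ_χ(s)⁻¹ [s q = q] λ_χ(g_q⁻¹ s g_q)`. -/
def cosetTerm (χ : Fin k → MulChar F ℂ) (q : GL (Fin (k + l)) F ⧸ flagStab F k l) : ℂ :=
  ∑ s : flagStab F k l, ((lam χ s : ℂˣ) : ℂ)⁻¹ *
    (if h : q.out⁻¹ * (s : GL (Fin (k + l)) F) * q.out ∈ flagStab F k l
      then ((lam χ ⟨_, h⟩ : ℂˣ) : ℂ) else 0)

/-- `|P'| ⟨Ψ_χ, Ψ_χ⟩ = ∑_q T(q)`. -/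
theorem card_mul_classInner_eq_sum (χ : Fin k → MulChar F ℂ) :
    (Fintype.card (flagStab F k l) : ℂ) * classInner (twChar (l := l) χ) (twChar χ) =
      ∑ q : GL (Fin (k + l)) F ⧸ flagStab F k l, cosetTerm χ q := by
  rw [card_mul_classInner]
  simp only [cosetTerm, twChar_apply, Finset.mul_sum]
  exact Finset.sum_comm

omit [Fintype F] in
/-- Conjugation into `P'` on the stabiliser of `q`. -/
def conjHom (q : GL (Fin (k + l)) F ⧸ flagStab F k l) :
    MulAction.stabilizer (flagStab F k l) q →* flagStab F k l where
  toFun h := ⟨(q.out : GL (Fin (k + l)) F)⁻¹ * ((h : flagStab F k l) : GL (Fin (k + l)) F) * q.out,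
    (smul_eq_self_iff_mem _ ((h : flagStab F k l) : GL (Fin (k + l)) F) q).mp
      (MulAction.mem_stabilizer_iff.mp h.2)⟩
  map_one' := Subtype.ext (by simp)
  map_mul' a b := Subtype.ext (by
    simp only [Subgroup.coe_mul]
    group)

/-- The linear character `f_q(s) = λ_χ(g_q⁻¹ s g_q) / λ_χ(s)` of the stabiliser `P'_q`. -/
def fq (χ : Fin k → MulChar F ℂ) (q : GL (Fin (k + l)) F ⧸ flagStab F k l) :
    MulAction.stabilizer (flagStab F k l) q →* ℂ :=
  (Units.coeHom ℂ).comp (((lam χ).comp (conjHom q)) /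
    ((lam χ).comp (MulAction.stabilizer (flagStab F k l) q).subtype))

omit [Fintype F] in
/-- Value of `f_q`. -/
theorem fq_apply (χ : Fin k → MulChar F ℂ) (q : GL (Fin (k + l)) F ⧸ flagStab F k l)
    (h : MulAction.stabilizer (flagStab F k l) q) :
    fq χ q h = ((lam χ (h : flagStab F k l) : ℂˣ) : ℂ)⁻¹ * ((lam χ (conjHom q h) : ℂˣ) : ℂ) := by
  show (((lam χ (conjHom q h) / lam χ (h : flagStab F k l) : ℂˣ)) : ℂ) = _
  rw [div_eq_mul_inv, Units.val_mul, Units.val_inv_eq_inv_val, mul_comm]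

/-- `T(q) = ∑_{s ∈ P'_q} f_q(s)`. -/
theorem cosetTerm_eq_sum_fq (χ : Fin k → MulChar F ℂ) (q : GL (Fin (k + l)) F ⧸ flagStab F k l) :
    cosetTerm χ q = ∑ h : MulAction.stabilizer (flagStab F k l) q, fq χ q h := by
  rw [cosetTerm, ← Finset.sum_filter_of_ne
    (p := fun s : flagStab F k l => s ∈ MulAction.stabilizer (flagStab F k l) q)
    (fun s _ hne => ?_)]
  · rw [Finset.sum_subtype (Finset.univ.filter fun s : flagStab F k l =>
        s ∈ MulAction.stabilizer (flagStab F k l) q)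
      (p := fun s : flagStab F k l => s ∈ MulAction.stabilizer (flagStab F k l) q)
      (fun s => by simp)]
    refine Finset.sum_congr rfl fun h _ => ?_
    have hmem : q.out⁻¹ * ((h : flagStab F k l) : GL (Fin (k + l)) F) * q.out ∈ flagStab F k l :=
      (smul_eq_self_iff_mem _ _ q).mp (MulAction.mem_stabilizer_iff.mp h.2)
    rw [dif_pos hmem, fq_apply]
    rfl
  · by_contra hno
    rw [dif_neg (fun hm => hno (MulAction.mem_stabilizer_iff.mpr
      ((smul_eq_self_iff_mem _ ((s : flagStab F k l) : GL (Fin (k + l)) F) q).mpr hm))),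
      mul_zero] at hne
    exact hne rfl

/-- **The base coset contributes `|P'|`.** -/
theorem cosetTerm_base (χ : Fin k → MulChar F ℂ) :
    cosetTerm (l := l) χ ((1 : GL (Fin (k + l)) F) : GL (Fin (k + l)) F ⧸ flagStab F k l) =
      (Fintype.card (flagStab F k l) : ℂ) := by
  obtain ⟨p₀, hp₀⟩ := QuotientGroup.mk_out_eq_mul (flagStab F k l) (1 : GL (Fin (k + l)) F)
  rw [cosetTerm]
  have h : ∀ s : flagStab F k l, ((lam χ s : ℂˣ) : ℂ)⁻¹ *
      (if h : ((1 : GL (Fin (k + l)) F) : GL (Fin (k + l)) F ⧸ flagStab F k l).out⁻¹ *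
          (s : GL (Fin (k + l)) F) *
          ((1 : GL (Fin (k + l)) F) : GL (Fin (k + l)) F ⧸ flagStab F k l).out ∈ flagStab F k l
        then ((lam χ ⟨_, h⟩ : ℂˣ) : ℂ) else 0) = 1 := by
    intro s
    have hmem : ((1 : GL (Fin (k + l)) F) : GL (Fin (k + l)) F ⧸ flagStab F k l).out⁻¹ *
        (s : GL (Fin (k + l)) F) *
        ((1 : GL (Fin (k + l)) F) : GL (Fin (k + l)) F ⧸ flagStab F k l).out ∈ flagStab F k l := by
      rw [hp₀, one_mul]
      exact mul_mem (mul_mem (inv_mem p₀.2) s.2) p₀.2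
    rw [dif_pos hmem]
    have e : lam χ ⟨_, hmem⟩ = lam χ s := by
      have e1 : (⟨_, hmem⟩ : flagStab F k l) = p₀⁻¹ * s * p₀ := Subtype.ext (by
        show ((1 : GL (Fin (k + l)) F) : GL (Fin (k + l)) F ⧸ flagStab F k l).out⁻¹ *
            (s : GL (Fin (k + l)) F) *
            ((1 : GL (Fin (k + l)) F) : GL (Fin (k + l)) F ⧸ flagStab F k l).out = _
        rw [hp₀, one_mul]
        rfl)
      rw [e1, map_mul, map_mul, map_inv, mul_comm _ (lam χ p₀), ← mul_assoc, mul_inv_cancel,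
        one_mul]
    rw [e, inv_mul_cancel₀ (Units.ne_zero _)]
  rw [Finset.sum_congr rfl fun s _ => h s, Finset.sum_const, Finset.card_univ, nsmul_eq_mul,
    mul_one]

/-! ## Non-base cosets contribute `0` -/

omit [Fintype F] in
/-- A non-base coset is `s₀ w(τ) P'` with `τ` moving one of `c_1, …, c_k`. -/
theorem exists_perm_moving {q : GL (Fin (k + l)) F ⧸ flagStab F k l}
    (hq : q ≠ ((1 : GL (Fin (k + l)) F) : GL (Fin (k + l)) F ⧸ flagStab F k l)) :
    ∃ τ : Equiv.Perm (Fin (k + l)), ∃ s₀ : flagStab F k l, ∃ j : Fin k,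
      τ (Fin.castAdd l j) ≠ Fin.castAdd l j ∧
      s₀ • ((permGL τ : GL (Fin (k + l)) F) : GL (Fin (k + l)) F ⧸ flagStab F k l) = q := by
  obtain ⟨τ, s₀, hs⟩ := exists_perm_orbit (F := F) (k := k) (l := l) q.out
  rw [QuotientGroup.out_eq'] at hs
  by_cases hτ : ∀ j : Fin k, τ (Fin.castAdd l j) = Fin.castAdd l j
  · exfalso
    apply hq
    have hw : ((permGL τ : GL (Fin (k + l)) F) : GL (Fin (k + l)) F ⧸ flagStab F k l) =
        ((1 : GL (Fin (k + l)) F) : GL (Fin (k + l)) F ⧸ flagStab F k l) :=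
      QuotientGroup.eq.mpr (by
        rw [mul_one]
        exact inv_mem (permGL_mem_flagStab hτ))
    rw [← hs, hw]
    show (((s₀ : GL (Fin (k + l)) F) * 1 : GL (Fin (k + l)) F) :
        GL (Fin (k + l)) F ⧸ flagStab F k l) = _
    refine QuotientGroup.eq.mpr ?_
    rw [mul_one, mul_one]
    exact inv_mem s₀.2
  · push Not at hτ
    obtain ⟨j, hj⟩ := hτ
    exact ⟨τ, s₀, j, hj, hs⟩

omit [Fintype F] in
/-- **`f_q ≠ 1` on a non-base coset** for distinct non-trivial `χ_i`. -/
theorem fq_ne_one {χ : Fin k → MulChar F ℂ} (hχ : Function.Injective χ) (hχ1 : ∀ i, χ i ≠ 1)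
    {q : GL (Fin (k + l)) F ⧸ flagStab F k l}
    (hq : q ≠ ((1 : GL (Fin (k + l)) F) : GL (Fin (k + l)) F ⧸ flagStab F k l)) :
    fq χ q ≠ 1 := by
  intro hf
  obtain ⟨τ, s₀, j, hj, hs⟩ := exists_perm_moving hq
  have hq2 : ((((s₀ : GL (Fin (k + l)) F) * permGL τ : GL (Fin (k + l)) F)) :
      GL (Fin (k + l)) F ⧸ flagStab F k l) = q := hs
  obtain ⟨p₀, hp₀⟩ := QuotientGroup.mk_out_eq_mul (flagStab F k l)
    ((s₀ : GL (Fin (k + l)) F) * permGL τ)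
  rw [hq2] at hp₀
  -- the value of `f_q` at the torus elements `s₀ diag(δ_d^x) s₀⁻¹`, `d = τ c_j`
  have hval : ∀ x : Fˣ, ((lam χ ⟨diagGL (Pi.mulSingle (τ (Fin.castAdd l j)) x),
      diagGL_mem (Pi.mulSingle (τ (Fin.castAdd l j)) x)⟩ : ℂˣ) : ℂ)⁻¹ * χ j (x : F) = 1 := by
    intro x
    have htP : diagGL (Pi.mulSingle (τ (Fin.castAdd l j)) x) ∈ flagStab F k l := diagGL_mem _
    have helt : (s₀ : GL (Fin (k + l)) F) * diagGL (Pi.mulSingle (τ (Fin.castAdd l j)) x) *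
        (s₀ : GL (Fin (k + l)) F)⁻¹ ∈ flagStab F k l :=
      mul_mem (mul_mem s₀.2 htP) (inv_mem s₀.2)
    have hmem' : (p₀ : GL (Fin (k + l)) F)⁻¹ * diagGL (Pi.mulSingle (Fin.castAdd l j) x) * (p₀ : GL
        (Fin (k + l)) F) ∈
        flagStab F k l := mul_mem (mul_mem (inv_mem p₀.2) (diagGL_mem _)) p₀.2
    have hconj : q.out⁻¹ * ((s₀ : GL (Fin (k + l)) F) *
        diagGL (Pi.mulSingle (τ (Fin.castAdd l j)) x) * (s₀ : GL (Fin (k + l)) F)⁻¹) * q.out =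
        (p₀ : GL (Fin (k + l)) F)⁻¹ * diagGL (Pi.mulSingle (Fin.castAdd l j) x) * (p₀ : GL (Fin (k
            + l)) F) := by
      rw [hp₀]
      have h1 : ((s₀ : GL (Fin (k + l)) F) * permGL τ * (p₀ : GL (Fin (k + l)) F))⁻¹ *
          ((s₀ : GL (Fin (k + l)) F) * diagGL (Pi.mulSingle (τ (Fin.castAdd l j)) x) *
            (s₀ : GL (Fin (k + l)) F)⁻¹) * ((s₀ : GL (Fin (k + l)) F) * permGL τ * (p₀ : GL (Fin (k
                + l)) F)) =
          (p₀ : GL (Fin (k + l)) F)⁻¹ * ((permGL τ)⁻¹ *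
            diagGL (Pi.mulSingle (τ (Fin.castAdd l j)) x) * permGL τ) * (p₀ : GL (Fin (k + l)) F)
                := by
        group
      rw [h1, conj_diagGL]
      congr 2
      refine congrArg diagGL (funext fun a => ?_)
      simp only [Pi.mulSingle_apply, EmbeddingLike.apply_eq_iff_eq]
    have hstab : (⟨_, helt⟩ : flagStab F k l) ∈ MulAction.stabilizer (flagStab F k l) q := by
      rw [MulAction.mem_stabilizer_iff]
      refine (smul_eq_self_iff_mem _ ((s₀ : GL (Fin (k + l)) F) *
        diagGL (Pi.mulSingle (τ (Fin.castAdd l j)) x) * (s₀ : GL (Fin (k + l)) F)⁻¹) q).mpr ?_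
      rw [hconj]
      exact hmem'
    have h1 := fq_apply χ q ⟨⟨_, helt⟩, hstab⟩
    rw [hf, MonoidHom.one_apply] at h1
    have e1 : lam χ (⟨(s₀ : GL (Fin (k + l)) F) * diagGL (Pi.mulSingle (τ (Fin.castAdd l j)) x) *
        (s₀ : GL (Fin (k + l)) F)⁻¹, helt⟩ : flagStab F k l) = lam χ ⟨_, htP⟩ := by
      have e : (⟨(s₀ : GL (Fin (k + l)) F) * diagGL (Pi.mulSingle (τ (Fin.castAdd l j)) x) *
          (s₀ : GL (Fin (k + l)) F)⁻¹, helt⟩ : flagStab F k l) = s₀ * ⟨_, htP⟩ * s₀⁻¹ := rfl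
      rw [e, map_mul, map_mul, map_inv, mul_comm (lam χ s₀) _, mul_assoc, mul_inv_cancel, mul_one]
    have e2 : conjHom q ⟨⟨_, helt⟩, hstab⟩ = ⟨_, hmem'⟩ := Subtype.ext hconj
    rw [e2, lam_conj χ p₀.2 (diagGL_mem _) hmem', lam_diagGL_mulSingle_castAdd] at h1
    have e1' : ((lam χ (((⟨⟨_, helt⟩, hstab⟩ : MulAction.stabilizer (flagStab F k l) q) :
        flagStab F k l)) : ℂˣ) : ℂ) = ((lam χ ⟨_, htP⟩ : ℂˣ) : ℂ) := by
      rw [← e1]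
    rw [e1'] at h1
    exact h1.symm
  by_cases hdc : ∃ i₁ : Fin k, Fin.castAdd l i₁ = τ (Fin.castAdd l j)
  · obtain ⟨i₁, hi₁⟩ := hdc
    have hne : i₁ ≠ j := by
      rintro rfl
      exact hj hi₁.symm
    apply hne
    apply hχ
    refine MulChar.ext fun x => ?_
    have h := hval x
    simp only [← hi₁] at h
    rw [lam_diagGL_mulSingle_castAdd] at h
    have hu : χ i₁ (x : F) ≠ 0 := by
      rw [← MulChar.coe_toUnitHom]
      exact Units.ne_zero _
    exact (inv_mul_eq_one₀ hu).mp h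
  · have hd : ∀ i : Fin k, Fin.castAdd l i ≠ τ (Fin.castAdd l j) := fun i h => hdc ⟨i, h⟩
    apply hχ1 j
    refine MulChar.ext fun x => ?_
    have h := hval x
    rw [lam_diagGL_mulSingle_of_ne χ hd, inv_one, one_mul] at h
    rw [h, MulChar.one_apply_coe]

/-- **A non-base coset contributes `0`.** -/
theorem cosetTerm_eq_zero {χ : Fin k → MulChar F ℂ} (hχ : Function.Injective χ)
    (hχ1 : ∀ i, χ i ≠ 1) {q : GL (Fin (k + l)) F ⧸ flagStab F k l}
    (hq : q ≠ ((1 : GL (Fin (k + l)) F) : GL (Fin (k + l)) F ⧸ flagStab F k l)) :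
    cosetTerm χ q = 0 := by
  rw [cosetTerm_eq_sum_fq]
  exact sum_hom_units_eq_zero _ (fq_ne_one hχ hχ1 hq)

/-! ## Orthonormality -/

/-- **`⟨Ψ_χ, Ψ_χ⟩ = 1`** for distinct non-trivial `χ_1, …, χ_k`. -/
theorem classInner_twChar {χ : Fin k → MulChar F ℂ} (hχ : Function.Injective χ)
    (hχ1 : ∀ i, χ i ≠ 1) : classInner (twChar (l := l) χ) (twChar χ) = 1 := by
  have hP : (Fintype.card (flagStab F k l) : ℂ) ≠ 0 := Nat.cast_ne_zero.mpr Fintype.card_ne_zero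
  have h := card_mul_classInner_eq_sum (l := l) χ
  rw [← Finset.add_sum_erase _ _ (Finset.mem_univ
      ((1 : GL (Fin (k + l)) F) : GL (Fin (k + l)) F ⧸ flagStab F k l)),
    Finset.sum_eq_zero (fun q hq => cosetTerm_eq_zero hχ hχ1 (Finset.ne_of_mem_erase hq)),
    add_zero, cosetTerm_base] at h
  exact mul_left_cancel₀ hP (h.trans (mul_one _).symm)

/-- **`Ψ_χ` is an irreducible character** for distinct non-trivial `χ_1, …, χ_k`. -/
theorem isIrrChar_twChar {χ : Fin k → MulChar F ℂ} (hχ : Function.Injective χ)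
    (hχ1 : ∀ i, χ i ≠ 1) : IsIrrChar (GL (Fin (k + l)) F) (twChar (l := l) χ) := by
  obtain ⟨m, hm, hsum⟩ := (isCharacter_twChar (l := l) χ).exists_multiset_irrChars
  have hone : classInner m.sum m.sum = 1 := by
    rw [← hsum]
    exact classInner_twChar hχ hχ1
  obtain ⟨ψ, rfl⟩ := multiset_eq_singleton hm hone
  rw [hsum, Multiset.sum_singleton]
  exact hm ψ (Multiset.mem_singleton_self ψ)

end FlagTwistNorm
end Summit.MatrixMultiplication.MatrixMultiplication.Theorems.SubgroupIdentityDesigns.Negative
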